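import Mathlib.RingTheory.MvPolynomial.Homogeneous
import Mathlib.Algebra.MvPolynomial.Degrees
import Mathlib.Data.Fintype.Basic
import Mathlib.Algebra.BigOperators.Group.Finset.Basic
import Mathlib.Algebra.BigOperators.Fin
import Mathlib.Tactic.DeriveFintype

/-!
# Gate quotients and the `×`-balanced expansion behind Tavenas' depth reduction

The algebraic core of the proof of the named fact
`Literature.Computability.AlgebraicComplexity.productDepthCircuitSize_two_le_of_isVPFamily` (`DepthReduction.lean`; the
discharge `productDepthCircuitSize_two_le_of_isVPFamily_holds` is assembled in the sibling
`DepthReductionProofs.lean`, which adds the circuit plumbing in the tree's `ArithCircuit`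
model). Source: S. Tavenas, *Improved bounds for reduction to depth 4 and depth 3*, Inform.
and Comput. 240 (2015) 2–11 (MFCS 2013), §4–§6 — homogenization (Prop. 2, folklore, and
Lemma 2), the gate quotients `(α;β)` of Valiant–Skyum–Berkowitz–Rackoff 1983 and the
`×`-balanced normal form of Agrawal–Vinay 2008 (Def. 4, Prop. 3, proved in §5), and the degree
cut behind Lemma 3 / Thm. 1 — the last step in the iterated-expansion form of Agrawal–Vinay
(expand every factor of large formal degree, count factors) rather than by Tavenas' parse-tree
count. Everything is carried out on VALUES (polynomials tagged with formal degrees), never on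
a syntactic circuit, so no circuit surgery is needed here. Mathlib-only imports.

## Contents

* `HKind`, `HomCircuit k σ ι`: a *homogeneous circuit certificate* on a node type `ι` — every
  node has a rank (references decrease the rank), a formal degree, a kind (variable, constant,
  weighted sum of nodes of the same formal degree, binary product) and a value, and the values
  satisfy the local equations (Tavenas §4: homogeneous circuits with unbounded weighted
  `+`-gates and binary `×`-gates; Tavenas' scalar `⊙`-gates are absorbed into the weights of
  `HKind.sum`, as in the tree's `ArithCircuit.Gate.sum`). `totalDegree_val_le` is Lemma 2
  (inequality form: `deg [ν] ≤ deg ν`).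
* `HomCircuit.quot ν μ`, the gate quotient `[ν : μ]` (Tavenas §5, gate `(α;β)`; VSBR 1983),
  defined by the recursion of §5 along the heavier child (`heavy` / `light` realise "reorder
  the children of each `×`-gate so that the rightmost child has the larger degree"):
  `quot_self`, `quot_sum`, `quot_prod`, `quot_eq_zero_of_deg_lt'` (`(α;β) = 0` off rightmost
  paths), `totalDegree_quot_le` (`deg (α;β) ≤ deg α − deg β`); the frontier `frontier m`
  (product nodes of formal degree `> m` whose two children have formal degree `≤ m`, i.e. the
  gates `γ` of Tavenas' inequalities (1)/(2)) and the two VSBR identities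
  `val_eq_sum_frontier` (`[α] = Σ_{γ ∈ F_m} [α:γ]·[γ]`) and `quot_eq_sum_frontier`
  (`[α:β] = Σ_{γ ∈ F_m} [α:γ]·[γ:β]`, Tavenas §5, eq. (3)).
* `Atom` (a node `[ν]` or a quotient `[ν:μ]`, with formal degree `adeg` and value `aval`),
  `nodeExp`, `quotExp`, `expandAtom`: ONE `×`-balanced expansion step (the two cases of the
  proof of Prop. 3 in §5): an atom of formal degree `D ≥ 2` is the sum of at most `#ι²`
  formal products ("terms", `List (Atom ι)`, value `tval`, formal degree `tdeg`) of at most `5`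
  atoms each of formal degree `≤ D/2`, every term having formal degree exactly `D`
  (`expandAtom_sum`, `expandAtom_tdeg`, `expandAtom_half`, `expandAtom_length_le`,
  `length_expandAtom_le`; Tavenas: fan-in `≤ 5`, size `s⁴ + 1`, "each child of degree at most
  half").
* `split`, `round1`, `roundAll`, `expand`, `bigCount`, `Inv`, `final_expand`,
  `HomCircuit.exists_sum_prod`: iterating the expansion at every atom of formal degree `> t`
  (Agrawal–Vinay). The potential `bigCount t T` = number of atoms of `T` of formal degree
  `> t/8` grows with every round at a non-final term (`two_le_countP`, the analogue of Tavenas'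
  count `|𝒢₀|, |𝒢₁| ≤ a` in the proof of Lemma 3) and is `≤ 8·deg/(t+1)` (`bigCount_mul_le`),
  so after `R = 8·deg ν/(t+1)` rounds every atom has formal degree `≤ t`: `val ν` is a sum of
  at most `(#ι²)^R` products of at most `1 + 4R` polynomials of total degree `≤ t` each.
* `SOperand`, `SLine`, `SLP k σ`: straight-line programs with two operands per line
  (Bürgisser 2000, Def. 2.1), again as certificates (lines, values, local equations; forward
  references read `0`); `SLP.homogenize d : HomCircuit k σ (Fin len × Tag d)`, the homogeneous
  components of degree `≤ d` of all lines (Prop. 2; `4·len·(d+1)²` nodes, `card_node_le`;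
  the `×`-lines use the Cauchy product `homogeneousComponent_mul`); and the structural theorem
  `SLP.exists_sum_prod`: for every `t ≥ 1`, a value of total degree `≤ d` of a straight-line
  program of length `L` is a sum of at most `(d+1)·(S·S)^{⌊8d/(t+1)⌋}` products of at most
  `1 + 4⌊8d/(t+1)⌋` polynomials of total degree `≤ t`, where `S = 4L(d+1)²`.

## Design notes and comparison with the printed proof

* Constants. Tavenas cuts at degree `d/a` with `a = √(d log n / log σ)` and bounds the top
  fan-in by counting parse trees (Lemma 3: size `1 + binom(σ+15a, 15a) + σ + σ·binom(n+d/a, d/a)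
  + n`). Here the cut `t` is a parameter (`DepthReductionProofs.lean` takes `t = ⌊√d⌋`) and the
  number of products is bounded by `(#ι²)^R`, `R = 8d/(t+1)`, i.e. `s^{O(√d)} = 2^{O(√d log s)}`
  for `t = √d` — the Agrawal–Vinay/Koiran form of the exponent rather than Tavenas' sharper
  `2^{O(√(d log(ds) log n))}`; for p-bounded `s, d` both are `(n+2)^{O(√d)}`, which is what
  the named fact states. Fan-in of the products `≤ 1 + 4R = O(√d)` (Tavenas: `15a`), bottom
  degree `≤ t`.
* Well-founded recursions on the circuit DAG are done by strong induction on `rank` (the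
  `_aux` lemmas) and, for the definition of `quot`, by a fuel argument (`quotFuel`,
  `quotFuel_eq`), which keeps the definitions structural.
* Junk values (documented at each definition): `children μ = (μ, μ)` at non-product nodes,
  `SOperand.evalAt` reads `0` at a forward reference, `hval` of an `R e a` node with `a > e`
  is `0`; none of them is reachable from the statements used downstream.

## References

* S. Tavenas, *Improved bounds for reduction to depth 4 and depth 3*, Inform. and Comput. 240
  (2015) 2–11; MFCS 2013, LNCS 8087, 813–824 (arXiv:1304.5777): Prop. 2, Lemma 2, Def. 4,
  Prop. 3 and its proof (§5), Lemma 3, Thm. 1 (§6).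
* L. G. Valiant, S. Skyum, S. Berkowitz, C. Rackoff, *Fast parallel computation of polynomials
  using few processors*, SIAM J. Comput. 12 (1983) 641–644 (gate quotients, the frontier
  identities).
* M. Agrawal, V. Vinay, *Arithmetic circuits: a chasm at depth four*, FOCS 2008, 67–75 (the
  `×`-balanced normal form and the expansion to depth four).
* P. Bürgisser, *Completeness and Reduction in Algebraic Complexity Theory*, Springer 2000,
  Def. 2.1 (straight-line programs).
-/

noncomputable section

open MvPolynomial

namespace Literature.Computability.AlgebraicComplexity.DepthReduction

universe u v w

/-! ## Homogeneous circuit certificates (Tavenas 2015, §4) -/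

/-- The kind of a node of a homogeneous circuit: a variable, a constant, a weighted sum of
earlier nodes of the same formal degree, or a binary product of earlier nodes.
[cite: Tavenas2015, §4, Prop. 2] -/
inductive HKind (k : Type u) (σ : Type v) (ι : Type w) : Type (max u v w)
  | var (j : σ) : HKind k σ ι
  | const (c : k) : HKind k σ ι
  | sum (args : List (k × ι)) : HKind k σ ι
  | prod (a b : ι) : HKind k σ ι

/-- A *homogeneous circuit certificate* on a node type `ι`: every node has a rank (references
go to nodes of smaller rank), a formal degree, a kind and a value, and the values satisfy the
local equations of the kinds (Tavenas 2015, §4, homogeneous circuits: `+`-gates have arguments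
of equal degree, the degree of a `×`-gate is the sum of the degrees of its two arguments). The
values are data; that they are the polynomials computed by the circuit is the content of the
local equations. [cite: Tavenas2015, §4, Prop. 2] -/
structure HomCircuit (k : Type u) (σ : Type v) (ι : Type w) [CommSemiring k] where
  /-- rank: references point to strictly smaller rank -/
  rank : ι → ℕ
  /-- formal degree -/
  deg : ι → ℕ
  /-- kind of the node -/
  kind : ι → HKind k σ ι
  /-- value of the node -/
  val : ι → MvPolynomial σ k
  wf_var : ∀ ν j, kind ν = .var j → val ν = X j ∧ deg ν = 1
  wf_const : ∀ ν c, kind ν = .const c → val ν = C c ∧ deg ν = 0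
  wf_sum : ∀ ν args, kind ν = .sum args →
    (∀ a ∈ args, rank a.2 < rank ν ∧ deg a.2 = deg ν) ∧
      val ν = (args.map fun a => a.1 • val a.2).sum
  wf_prod : ∀ ν a b, kind ν = .prod a b →
    rank a < rank ν ∧ rank b < rank ν ∧ deg ν = deg a + deg b ∧ val ν = val a * val b

namespace HomCircuit

variable {k : Type u} {σ : Type v} {ι : Type w} [CommSemiring k]
variable (H : HomCircuit k σ ι)

/-- The heavier of two nodes (by formal degree; ties go to the second).
[cite: Tavenas2015, §5 (proof of Prop. 3)] -/
def heavy (a b : ι) : ι := if H.deg a ≤ H.deg b then b else a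

/-- The lighter of two nodes (by formal degree; ties go to the first).
[cite: Tavenas2015, §5 (proof of Prop. 3)] -/
def light (a b : ι) : ι := if H.deg a ≤ H.deg b then a else b

/-- The lighter child has formal degree at most that of the heavier child. [cite: Tavenas2015, §5
(proof of Prop. 3)] -/
theorem deg_light_le (a b : ι) : H.deg (H.light a b) ≤ H.deg (H.heavy a b) := by
  unfold light heavy
  split_ifs with h
  · exact h
  · exact (Nat.lt_of_not_le h).le

/-- The formal degrees of the lighter and heavier child add up to those of the two children. [cite:
Tavenas2015, §5 (proof of Prop. 3)] -/
theorem deg_light_add (a b : ι) :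
    H.deg (H.light a b) + H.deg (H.heavy a b) = H.deg a + H.deg b := by
  unfold light heavy
  split_ifs with h
  · rfl
  · exact Nat.add_comm _ _

/-- The values of the lighter and heavier child multiply to the product of the two children. [cite:
Tavenas2015, §5 (proof of Prop. 3)] -/
theorem val_light_mul (a b : ι) :
    H.val (H.light a b) * H.val (H.heavy a b) = H.val a * H.val b := by
  unfold light heavy
  split_ifs with h
  · rfl
  · exact mul_comm _ _

/-- The heavier child of a product node has smaller rank. [cite: Tavenas2015, §5 (proof of Prop. 3)]
-/
theorem rank_heavy_lt {ν a b : ι} (h : H.kind ν = .prod a b) : H.rank (H.heavy a b) < H.rank ν := by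
  obtain ⟨ha, hb, -, -⟩ := H.wf_prod ν a b h
  unfold heavy
  split_ifs
  · exact hb
  · exact ha

/-- The lighter child of a product node has smaller rank. [cite: Tavenas2015, §5 (proof of Prop. 3)]
-/
theorem rank_light_lt {ν a b : ι} (h : H.kind ν = .prod a b) : H.rank (H.light a b) < H.rank ν := by
  obtain ⟨ha, hb, -, -⟩ := H.wf_prod ν a b h
  unfold light
  split_ifs
  · exact ha
  · exact hb

/-- The formal degree of a product node is the sum of the degrees of its lighter and heavier child.
[cite: Tavenas2015, §4, Prop. 2] -/
theorem deg_prod_eq {ν a b : ι} (h : H.kind ν = .prod a b) :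
    H.deg ν = H.deg (H.light a b) + H.deg (H.heavy a b) := by
  rw [deg_light_add]
  exact (H.wf_prod ν a b h).2.2.1

/-- The value of a product node is the product of the values of its lighter and heavier child.
[cite: Tavenas2015, §4, Prop. 2] -/
theorem val_prod_eq {ν a b : ι} (h : H.kind ν = .prod a b) :
    H.val ν = H.val (H.light a b) * H.val (H.heavy a b) := by
  rw [val_light_mul]
  exact (H.wf_prod ν a b h).2.2.2

/-- The heavier child of a product node has formal degree at most that of the node. [cite:
Tavenas2015, §4, Prop. 2] -/
theorem deg_heavy_le {ν a b : ι} (h : H.kind ν = .prod a b) : H.deg (H.heavy a b) ≤ H.deg ν := by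
  rw [H.deg_prod_eq h]
  exact Nat.le_add_left _ _

/-- The lighter child of a product node has formal degree at most that of the node. [cite:
Tavenas2015, §4, Prop. 2] -/
theorem deg_light_le' {ν a b : ι} (h : H.kind ν = .prod a b) : H.deg (H.light a b) ≤ H.deg ν := by
  rw [H.deg_prod_eq h]
  exact Nat.le_add_right _ _

/-- Sums over lists: a uniform bound on the summands bounds the total degree of the sum.
[folklore] -/
theorem _root_.Literature.Computability.AlgebraicComplexity.DepthReduction.totalDegree_list_sum_le {l : List (MvPolynomial σ k)}
    {d : ℕ} (h : ∀ p ∈ l, p.totalDegree ≤ d) : l.sum.totalDegree ≤ d := by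
  induction l with
  | nil => simp
  | cons p l ih =>
    rw [List.sum_cons]
    exact (totalDegree_add _ _).trans (max_le (h p (by simp)) (ih fun q hq => h q (by simp [hq])))

/-- A variable has total degree at most `1` (no nontriviality assumption). [folklore] -/
theorem _root_.Literature.Computability.AlgebraicComplexity.DepthReduction.totalDegree_X_le (j : σ) :
    (X j : MvPolynomial σ k).totalDegree ≤ 1 :=
  (totalDegree_monomial_le _ _).trans (by simp)

/-- Degree bound: `deg (val ν) ≤ deg ν`. [cite: Tavenas2015, §4, Lemma 2] -/
theorem totalDegree_val_le_aux : ∀ (n : ℕ) (ν : ι), H.rank ν = n →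
    (H.val ν).totalDegree ≤ H.deg ν := by
  intro n
  induction n using Nat.strong_induction_on with
  | _ n ih =>
    intro ν hn
    cases hkind : H.kind ν with
    | var j =>
      obtain ⟨h1, h2⟩ := H.wf_var ν j hkind
      rw [h1, h2]
      exact totalDegree_X_le j
    | const c =>
      obtain ⟨h1, h2⟩ := H.wf_const ν c hkind
      rw [h1, totalDegree_C]
      exact Nat.zero_le _
    | sum args =>
      obtain ⟨hargs, hv⟩ := H.wf_sum ν args hkind
      rw [hv]
      apply totalDegree_list_sum_le
      intro p hp
      obtain ⟨a, ha, rfl⟩ := List.mem_map.1 hp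
      obtain ⟨hr, hd⟩ := hargs a ha
      exact (totalDegree_smul_le _ _).trans (hd ▸ ih _ (hn ▸ hr) a.2 rfl)
    | prod a b =>
      obtain ⟨hra, hrb, hd, hv⟩ := H.wf_prod ν a b hkind
      rw [hv, hd]
      exact (totalDegree_mul _ _).trans
        (Nat.add_le_add (ih _ (hn ▸ hra) a rfl) (ih _ (hn ▸ hrb) b rfl))

/-- Degree bound: the value of a node has total degree at most its formal degree (Tavenas 2015,
Lemma 2, inequality form). [cite: Tavenas2015, §4, Lemma 2] -/
theorem totalDegree_val_le (ν : ι) : (H.val ν).totalDegree ≤ H.deg ν :=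
  H.totalDegree_val_le_aux _ ν rfl

/-! ## Gate quotients (Valiant–Skyum–Berkowitz–Rackoff; Tavenas 2015, §5) -/

section Quot

variable [DecidableEq ι]

/-- Fuel-bounded recursion for the gate quotient.
[cite: Tavenas2015, §5 (gates (α;β)); ValiantSkyumBerkowitzRackoff1983] -/
def quotFuel : ℕ → ι → ι → MvPolynomial σ k
  | 0, _, _ => 0
  | n + 1, ν, μ =>
    if ν = μ then 1 else
      match H.kind ν with
      | .sum args => (args.map fun a => a.1 • quotFuel n a.2 μ).sum
      | .prod a b => H.val (H.light a b) * quotFuel n (H.heavy a b) μ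
      | .var _ => 0
      | .const _ => 0

/-- The *gate quotient* `[ν : μ]` of Valiant–Skyum–Berkowitz–Rackoff / Tavenas 2015 §5: `1` if
`ν = μ`; for a sum node the corresponding weighted sum of the quotients of its arguments; for a
product node, the value of the lighter child times the quotient of the heavier child; `0` at
leaves. [cite: Tavenas2015, §5 (gates (α;β)); ValiantSkyumBerkowitzRackoff1983] -/
def quot (ν μ : ι) : MvPolynomial σ k := H.quotFuel (H.rank ν + 1) ν μ

/-- The fuel-bounded recursion stabilises as soon as the fuel exceeds the rank. [folklore] -/
theorem quotFuel_eq (μ : ι) : ∀ n ν, H.rank ν < n → H.quotFuel n ν μ = H.quot ν μ := by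
  intro n
  induction n using Nat.strong_induction_on with
  | _ n ih =>
    intro ν hν
    obtain ⟨n, rfl⟩ : ∃ n', n = n' + 1 := ⟨n - 1, by omega⟩
    unfold quot
    simp only [quotFuel]
    split_ifs with hνμ
    · rfl
    · cases hkind : H.kind ν with
      | var j => rfl
      | const c => rfl
      | sum args =>
        simp only
        congr 1
        apply List.map_congr_left
        intro a ha
        have hr := ((H.wf_sum ν args hkind).1 a ha).1
        rw [ih n (Nat.lt_succ_self n) a.2 (by omega), ih (H.rank ν) hν a.2 hr]
      | prod a b =>
        simp only
        have hr := H.rank_heavy_lt hkind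
        rw [ih n (Nat.lt_succ_self n) _ (by omega), ih (H.rank ν) hν _ hr]

/-- `[ν : ν] = 1` (Tavenas 2015, §5, case `α = β`). [cite: Tavenas2015, §5 (proof of Prop. 3)] -/
@[simp]
theorem quot_self (ν : ι) : H.quot ν ν = 1 := by
  simp [quot, quotFuel]

/-- Quotient of a sum node: the weighted sum of the quotients of its arguments (Tavenas 2015, §5,
`+`-gate case). [cite: Tavenas2015, §5 (proof of Prop. 3)] -/
theorem quot_sum {ν μ : ι} {args : List (k × ι)} (h : H.kind ν = .sum args) (hne : ν ≠ μ) :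
    H.quot ν μ = (args.map fun a => a.1 • H.quot a.2 μ).sum := by
  conv_lhs => rw [quot, quotFuel, if_neg hne, h]
  simp only
  congr 1
  apply List.map_congr_left
  intro a ha
  rw [H.quotFuel_eq μ _ _ ((H.wf_sum ν args h).1 a ha).1]

/-- Quotient of a product node: value of the lighter child times the quotient of the heavier child
(Tavenas 2015, §5, `×`-gate case, one step). [cite: Tavenas2015, §5 (proof of Prop. 3)] -/
theorem quot_prod {ν μ a b : ι} (h : H.kind ν = .prod a b) (hne : ν ≠ μ) :
    H.quot ν μ = H.val (H.light a b) * H.quot (H.heavy a b) μ := by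
  conv_lhs => rw [quot, quotFuel, if_neg hne, h]
  simp only
  rw [H.quotFuel_eq μ _ _ (H.rank_heavy_lt h)]

/-- Quotient of a variable leaf by another node is `0`. [cite: Tavenas2015, §5 (proof of Prop. 3)]
-/
theorem quot_var {ν μ : ι} {j : σ} (h : H.kind ν = .var j) (hne : ν ≠ μ) : H.quot ν μ = 0 := by
  rw [quot, quotFuel, if_neg hne, h]

/-- Quotient of a constant leaf by another node is `0`. [cite: Tavenas2015, §5 (proof of Prop. 3)]
-/
theorem quot_const {ν μ : ι} {c : k} (h : H.kind ν = .const c) (hne : ν ≠ μ) : H.quot ν μ = 0 := by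
  rw [quot, quotFuel, if_neg hne, h]

/-- L0: a quotient `[ν : μ]` with `deg ν < deg μ` vanishes.
[cite: Tavenas2015, §5 (proof of Prop. 3)] -/
theorem quot_eq_zero_of_deg_lt : ∀ (n : ℕ) (ν μ : ι), H.rank ν = n → H.deg ν < H.deg μ →
    H.quot ν μ = 0 := by
  intro n
  induction n using Nat.strong_induction_on with
  | _ n ih =>
    intro ν μ hn hdeg
    have hne : ν ≠ μ := fun h => by subst h; exact lt_irrefl _ hdeg
    cases hkind : H.kind ν with
    | var j => exact H.quot_var hkind hne
    | const c => exact H.quot_const hkind hne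
    | sum args =>
      rw [H.quot_sum hkind hne]
      apply List.sum_eq_zero
      intro x hx
      obtain ⟨a, ha, rfl⟩ := List.mem_map.1 hx
      obtain ⟨hr, hd⟩ := (H.wf_sum ν args hkind).1 a ha
      rw [ih (H.rank a.2) (hn ▸ hr) a.2 μ rfl (hd ▸ hdeg), smul_zero]
    | prod a b =>
      rw [H.quot_prod hkind hne, ih (H.rank (H.heavy a b)) (hn ▸ H.rank_heavy_lt hkind) _ μ rfl
        ((H.deg_heavy_le hkind).trans_lt hdeg), mul_zero]

/-- L0: `[ν : μ] = 0` when `deg ν < deg μ` (Tavenas 2015, §5: `(α;β) = 0` if `β` is not on a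
rightmost path from `α`). [cite: Tavenas2015, §5 (proof of Prop. 3)] -/
theorem quot_eq_zero_of_deg_lt' {ν μ : ι} (hdeg : H.deg ν < H.deg μ) : H.quot ν μ = 0 :=
  H.quot_eq_zero_of_deg_lt _ ν μ rfl hdeg

/-- Degree bound: `deg [ν : μ] ≤ deg ν - deg μ`. [cite: Tavenas2015, §5 (proof of Prop. 3)] -/
theorem totalDegree_quot_le_aux (μ : ι) : ∀ (n : ℕ) (ν : ι), H.rank ν = n →
    (H.quot ν μ).totalDegree ≤ H.deg ν - H.deg μ := by
  intro n
  induction n using Nat.strong_induction_on with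
  | _ n ih =>
    intro ν hn
    by_cases hne : ν = μ
    · subst hne
      simp
    cases hkind : H.kind ν with
    | var j => rw [H.quot_var hkind hne, totalDegree_zero]; exact Nat.zero_le _
    | const c => rw [H.quot_const hkind hne, totalDegree_zero]; exact Nat.zero_le _
    | sum args =>
      rw [H.quot_sum hkind hne]
      apply totalDegree_list_sum_le
      intro p hp
      obtain ⟨a, ha, rfl⟩ := List.mem_map.1 hp
      obtain ⟨hr, hd⟩ := (H.wf_sum ν args hkind).1 a ha
      exact (totalDegree_smul_le _ _).trans (hd ▸ ih _ (hn ▸ hr) a.2 rfl)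
    | prod a b =>
      rw [H.quot_prod hkind hne]
      by_cases hlt : H.deg (H.heavy a b) < H.deg μ
      · rw [H.quot_eq_zero_of_deg_lt' hlt, mul_zero, totalDegree_zero]
        exact Nat.zero_le _
      · refine (totalDegree_mul _ _).trans ?_
        refine (Nat.add_le_add (H.totalDegree_val_le _)
          (ih _ (hn ▸ H.rank_heavy_lt hkind) _ rfl)).trans ?_
        rw [H.deg_prod_eq hkind]
        omega

/-- Degree bound: `deg [ν : μ] ≤ deg ν - deg μ` (Tavenas 2015, §5, `deg(α;β) = deg α - deg β`,
inequality form). [cite: Tavenas2015, §5 (proof of Prop. 3)] -/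
theorem totalDegree_quot_le (ν μ : ι) : (H.quot ν μ).totalDegree ≤ H.deg ν - H.deg μ :=
  H.totalDegree_quot_le_aux μ _ ν rfl

omit [DecidableEq ι] in
/-- The first child has formal degree at most that of the heavier child. [cite: Tavenas2015, §5
(proof of Prop. 3)] -/
theorem le_deg_heavy_left (a b : ι) : H.deg a ≤ H.deg (H.heavy a b) := by
  unfold heavy; split_ifs with h
  · exact h
  · exact le_rfl

omit [DecidableEq ι] in
/-- The second child has formal degree at most that of the heavier child. [cite: Tavenas2015, §5
(proof of Prop. 3)] -/
theorem le_deg_heavy_right (a b : ι) : H.deg b ≤ H.deg (H.heavy a b) := by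
  unfold heavy; split_ifs with h
  · exact le_rfl
  · exact (Nat.lt_of_not_le h).le

/-! ### The frontier identities -/

section Frontier

variable [Fintype ι]

open Classical in
/-- The frontier `F_m` (VSBR): product nodes of formal degree `> m` both of whose children have
formal degree `≤ m`. [cite: Tavenas2015, §5, eqs. (1)–(2); ValiantSkyumBerkowitzRackoff1983] -/
def frontier (m : ℕ) : Finset ι :=
  Finset.univ.filter fun μ => ∃ a b, H.kind μ = .prod a b ∧ m < H.deg μ ∧ H.deg a ≤ m ∧ H.deg b ≤ m

omit [DecidableEq ι] in
/-- Membership in the frontier `F_m`, unfolded. [cite: ValiantSkyumBerkowitzRackoff1983] -/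
theorem mem_frontier {m : ℕ} {μ : ι} : μ ∈ H.frontier m ↔
    ∃ a b, H.kind μ = .prod a b ∧ m < H.deg μ ∧ H.deg a ≤ m ∧ H.deg b ≤ m := by
  classical
  simp [frontier]

/-- Commuting a list sum with a `Finset` sum. [folklore] -/
theorem _root_.Literature.Computability.AlgebraicComplexity.DepthReduction.list_sum_finset_sum {α β M : Type*} [AddCommMonoid M]
    (l : List α) (s : Finset β) (F : α → β → M) :
    (l.map fun a => ∑ b ∈ s, F a b).sum = ∑ b ∈ s, (l.map fun a => F a b).sum := by
  induction l with
  | nil => simp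
  | cons a l ih => simp [ih, Finset.sum_add_distrib]

omit [DecidableEq ι] in
/-- A product node of degree `> m` outside the frontier `F_m` has its heavier child of degree `> m`
(the rightmost path continues). [cite: ValiantSkyumBerkowitzRackoff1983] -/
theorem deg_heavy_gt_of_not_mem_frontier {m : ℕ} {ν a b : ι} (hkind : H.kind ν = .prod a b)
    (hdeg : m < H.deg ν) (hν : ν ∉ H.frontier m) : m < H.deg (H.heavy a b) := by
  by_contra h
  rw [not_lt] at h
  exact hν (H.mem_frontier.2 ⟨a, b, hkind, hdeg, (H.le_deg_heavy_left a b).trans h,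
    (H.le_deg_heavy_right a b).trans h⟩)

/-- L1 (VSBR, Tavenas 2015 §5): for `1 ≤ m < deg ν`, `val ν = Σ_{μ ∈ F_m} [ν : μ] · val μ`.
[cite: Tavenas2015, §5, eq. before (1) and eq. (1); ValiantSkyumBerkowitzRackoff1983] -/
theorem val_eq_sum_frontier_aux {m : ℕ} (hm : 1 ≤ m) : ∀ (n : ℕ) (ν : ι), H.rank ν = n →
    m < H.deg ν → H.val ν = ∑ μ ∈ H.frontier m, H.quot ν μ * H.val μ := by
  intro n
  induction n using Nat.strong_induction_on with
  | _ n ih =>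
    intro ν hn hdeg
    cases hkind : H.kind ν with
    | var j => have := (H.wf_var ν j hkind).2; omega
    | const c => have := (H.wf_const ν c hkind).2; omega
    | sum args =>
      obtain ⟨hargs, hv⟩ := H.wf_sum ν args hkind
      have hne : ∀ μ ∈ H.frontier m, ν ≠ μ := by
        rintro μ hμ rfl
        obtain ⟨a, b, hk, -⟩ := H.mem_frontier.1 hμ
        rw [hkind] at hk; cases hk
      calc H.val ν = (args.map fun a => a.1 • H.val a.2).sum := hv
        _ = (args.map fun a => ∑ μ ∈ H.frontier m, a.1 • (H.quot a.2 μ * H.val μ)).sum := by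
          congr 1
          apply List.map_congr_left
          intro a ha
          obtain ⟨hr, hd⟩ := hargs a ha
          rw [ih _ (hn ▸ hr) a.2 rfl (hd ▸ hdeg), Finset.smul_sum]
        _ = ∑ μ ∈ H.frontier m, (args.map fun a => a.1 • (H.quot a.2 μ * H.val μ)).sum :=
          list_sum_finset_sum _ _ _
        _ = ∑ μ ∈ H.frontier m, H.quot ν μ * H.val μ := by
          apply Finset.sum_congr rfl
          intro μ hμ
          rw [H.quot_sum hkind (hne μ hμ), ← List.sum_map_mul_right]
          simp only [smul_mul_assoc]
    | prod a b =>
      by_cases hν : ν ∈ H.frontier m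
      · rw [Finset.sum_eq_single ν]
        · simp
        · intro μ hμ hμν
          obtain ⟨a', b', hk', hdμ, ha', hb'⟩ := H.mem_frontier.1 hν
          rw [hkind] at hk'; cases hk'
          rw [H.quot_prod hkind (Ne.symm hμν), H.quot_eq_zero_of_deg_lt', mul_zero, zero_mul]
          obtain ⟨-, -, -, hdμ', -⟩ := H.mem_frontier.1 hμ
          refine lt_of_le_of_lt ?_ hdμ'
          unfold heavy; split_ifs
          · exact hb'
          · exact ha'
        · intro h; exact absurd hν h
      · have hh := H.deg_heavy_gt_of_not_mem_frontier hkind hdeg hν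
        have hne : ∀ μ ∈ H.frontier m, ν ≠ μ := by
          rintro μ hμ rfl; exact hν hμ
        rw [H.val_prod_eq hkind, ih _ (hn ▸ H.rank_heavy_lt hkind) _ rfl hh, Finset.mul_sum]
        apply Finset.sum_congr rfl
        intro μ hμ
        rw [H.quot_prod hkind (hne μ hμ), mul_assoc]

/-- L1 (VSBR; Tavenas 2015 §5): for `1 ≤ m < deg ν`, `val ν = Σ_{μ ∈ F_m} [ν : μ] · val μ`. [cite:
Tavenas2015, §5; ValiantSkyumBerkowitzRackoff1983] -/
theorem val_eq_sum_frontier {m : ℕ} (hm : 1 ≤ m) {ν : ι} (hdeg : m < H.deg ν) :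
    H.val ν = ∑ μ ∈ H.frontier m, H.quot ν μ * H.val μ :=
  H.val_eq_sum_frontier_aux hm _ ν rfl hdeg

/-- L2 (VSBR, Tavenas 2015 §5): for `1 ≤ m`, `deg μ ≤ m < deg ν`,
`[ν : μ] = Σ_{w ∈ F_m} [ν : w] · [w : μ]`.
[cite: Tavenas2015, §5, eqs. (2)–(3); ValiantSkyumBerkowitzRackoff1983] -/
theorem quot_eq_sum_frontier_aux {m : ℕ} (hm : 1 ≤ m) {μ : ι} (hμ : H.deg μ ≤ m) :
    ∀ (n : ℕ) (ν : ι), H.rank ν = n →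
    m < H.deg ν → H.quot ν μ = ∑ w ∈ H.frontier m, H.quot ν w * H.quot w μ := by
  intro n
  induction n using Nat.strong_induction_on with
  | _ n ih =>
    intro ν hn hdeg
    have hνμ : ν ≠ μ := by rintro rfl; omega
    cases hkind : H.kind ν with
    | var j => have := (H.wf_var ν j hkind).2; omega
    | const c => have := (H.wf_const ν c hkind).2; omega
    | sum args =>
      obtain ⟨hargs, hv⟩ := H.wf_sum ν args hkind
      have hne : ∀ w ∈ H.frontier m, ν ≠ w := by
        rintro w hw rfl
        obtain ⟨a, b, hk, -⟩ := H.mem_frontier.1 hw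
        rw [hkind] at hk; cases hk
      calc H.quot ν μ = (args.map fun a => a.1 • H.quot a.2 μ).sum := H.quot_sum hkind hνμ
        _ = (args.map fun a => ∑ w ∈ H.frontier m, a.1 • (H.quot a.2 w * H.quot w μ)).sum := by
          congr 1
          apply List.map_congr_left
          intro a ha
          obtain ⟨hr, hd⟩ := hargs a ha
          rw [ih _ (hn ▸ hr) a.2 rfl (hd ▸ hdeg), Finset.smul_sum]
        _ = ∑ w ∈ H.frontier m, (args.map fun a => a.1 • (H.quot a.2 w * H.quot w μ)).sum :=
          list_sum_finset_sum _ _ _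
        _ = ∑ w ∈ H.frontier m, H.quot ν w * H.quot w μ := by
          apply Finset.sum_congr rfl
          intro w hw
          rw [H.quot_sum hkind (hne w hw), ← List.sum_map_mul_right]
          simp only [smul_mul_assoc]
    | prod a b =>
      by_cases hν : ν ∈ H.frontier m
      · rw [Finset.sum_eq_single ν]
        · simp
        · intro w hw hwν
          obtain ⟨a', b', hk', hdν, ha', hb'⟩ := H.mem_frontier.1 hν
          rw [hkind] at hk'; cases hk'
          rw [H.quot_prod hkind (Ne.symm hwν), H.quot_eq_zero_of_deg_lt' (ν := H.heavy a b),
            mul_zero, zero_mul]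
          obtain ⟨-, -, -, hdw, -⟩ := H.mem_frontier.1 hw
          refine lt_of_le_of_lt ?_ hdw
          unfold heavy; split_ifs
          · exact hb'
          · exact ha'
        · intro h; exact absurd hν h
      · have hh := H.deg_heavy_gt_of_not_mem_frontier hkind hdeg hν
        have hne : ∀ w ∈ H.frontier m, ν ≠ w := by
          rintro w hw rfl; exact hν hw
        rw [H.quot_prod hkind hνμ, ih _ (hn ▸ H.rank_heavy_lt hkind) _ rfl hh, Finset.mul_sum]
        apply Finset.sum_congr rfl
        intro w hw
        rw [H.quot_prod hkind (hne w hw), mul_assoc]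

/-- L2 (VSBR; Tavenas 2015 §5, eq. (3)): for `1 ≤ m`, `deg μ ≤ m < deg ν`, `[ν : μ] = Σ_{w ∈ F_m} [ν
: w] · [w : μ]`. [cite: Tavenas2015, §5, eq. (3); ValiantSkyumBerkowitzRackoff1983] -/
theorem quot_eq_sum_frontier {m : ℕ} (hm : 1 ≤ m) {ν μ : ι} (hμ : H.deg μ ≤ m)
    (hdeg : m < H.deg ν) :
    H.quot ν μ = ∑ w ∈ H.frontier m, H.quot ν w * H.quot w μ :=
  H.quot_eq_sum_frontier_aux hm hμ _ ν rfl hdeg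

end Frontier


omit [DecidableEq ι] in
/-- If both children have formal degree `≤ m` then so does the heavier child. [cite: Tavenas2015, §5
(proof of Prop. 3)] -/
theorem deg_heavy_le_of {a b : ι} {m : ℕ} (ha : H.deg a ≤ m) (hb : H.deg b ≤ m) :
    H.deg (H.heavy a b) ≤ m := by
  unfold heavy; split_ifs
  · exact hb
  · exact ha

/-! ## Atoms and terms -/

section Atoms

/-- An *atom* of the expansion: a node `[ν]` or a gate quotient `[ν : μ]`.
[cite: Tavenas2015, §5 (proof of Prop. 3)] -/
inductive Atom (ι : Type w) : Type w
  | node (ν : ι) : Atom ι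
  | quot (ν μ : ι) : Atom ι

/-- Formal degree of an atom. [cite: Tavenas2015, §5 (proof of Prop. 3)] -/
def adeg : Atom ι → ℕ
  | .node ν => H.deg ν
  | .quot ν μ => H.deg ν - H.deg μ

/-- Value of an atom. [cite: Tavenas2015, §5 (proof of Prop. 3)] -/
def aval : Atom ι → MvPolynomial σ k
  | .node ν => H.val ν
  | .quot ν μ => H.quot ν μ

omit [DecidableEq ι] in
/-- Formal degree of a node atom. [cite: Tavenas2015, §5 (proof of Prop. 3)] -/
@[simp] theorem adeg_node (ν : ι) : H.adeg (.node ν) = H.deg ν := rfl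

omit [DecidableEq ι] in
/-- Formal degree of a quotient atom. [cite: Tavenas2015, §5 (proof of Prop. 3)] -/
@[simp] theorem adeg_quot (ν μ : ι) : H.adeg (.quot ν μ) = H.deg ν - H.deg μ := rfl

/-- Value of a node atom. [cite: Tavenas2015, §5 (proof of Prop. 3)] -/
@[simp] theorem aval_node (ν : ι) : H.aval (.node ν) = H.val ν := rfl

/-- Value of a quotient atom. [cite: Tavenas2015, §5 (proof of Prop. 3)] -/
@[simp] theorem aval_quot (ν μ : ι) : H.aval (.quot ν μ) = H.quot ν μ := rfl

/-- The value of an atom has total degree at most its formal degree. [cite: Tavenas2015, §5 (proof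
of Prop. 3)] -/
theorem totalDegree_aval_le (a : Atom ι) : (H.aval a).totalDegree ≤ H.adeg a := by
  cases a with
  | node ν => exact H.totalDegree_val_le ν
  | quot ν μ => exact H.totalDegree_quot_le ν μ

/-- Value of a term (product of the atom values).
[cite: Tavenas2015, §6, Lemma 3 and proof of Thm. 1] -/
def tval (T : List (Atom ι)) : MvPolynomial σ k := (T.map H.aval).prod

/-- Formal degree of a term (sum of the atom degrees).
[cite: Tavenas2015, §6, Lemma 3 and proof of Thm. 1] -/
def tdeg (T : List (Atom ι)) : ℕ := (T.map H.adeg).sum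

/-- Value of the empty term. [folklore] -/
@[simp] theorem tval_nil : H.tval [] = 1 := rfl

/-- Value of a term, cons form. [folklore] -/
@[simp] theorem tval_cons (a : Atom ι) (T : List (Atom ι)) :
    H.tval (a :: T) = H.aval a * H.tval T := by
  simp [tval]

/-- Value of a concatenation of terms. [folklore] -/
@[simp] theorem tval_append (T T' : List (Atom ι)) : H.tval (T ++ T') = H.tval T * H.tval T' := by
  simp [tval]

omit [DecidableEq ι] in
/-- Formal degree of the empty term. [folklore] -/
@[simp] theorem tdeg_nil : H.tdeg [] = 0 := rfl

omit [DecidableEq ι] in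
/-- Formal degree of a term, cons form. [folklore] -/
@[simp] theorem tdeg_cons (a : Atom ι) (T : List (Atom ι)) :
    H.tdeg (a :: T) = H.adeg a + H.tdeg T := by
  simp [tdeg]

omit [DecidableEq ι] in
/-- Formal degree of a concatenation of terms. [folklore] -/
@[simp] theorem tdeg_append (T T' : List (Atom ι)) : H.tdeg (T ++ T') = H.tdeg T + H.tdeg T' := by
  simp [tdeg]

end Atoms

/-! ## One `×`-balanced expansion step (Tavenas 2015, §5, proof of Prop. 3) -/

section Expansion

variable [Fintype ι]

/-- The two children of a product node (junk `(μ, μ)` at other nodes).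
[cite: Tavenas2015, §4, Prop. 2] -/
def children (μ : ι) : ι × ι :=
  match H.kind μ with
  | .prod a b => (a, b)
  | _ => (μ, μ)

omit [DecidableEq ι] in
/-- A frontier node is a product node of degree `> m` whose two children have degree `≤ m`. [cite:
ValiantSkyumBerkowitzRackoff1983] -/
theorem of_mem_frontier {m : ℕ} {μ : ι} (h : μ ∈ H.frontier m) :
    H.kind μ = .prod (H.children μ).1 (H.children μ).2 ∧ m < H.deg μ ∧
      H.deg (H.children μ).1 ≤ m ∧ H.deg (H.children μ).2 ≤ m := by
  obtain ⟨a, b, hk, hd, ha, hb⟩ := H.mem_frontier.1 h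
  have hc : H.children μ = (a, b) := by simp [children, hk]
  rw [hc]
  exact ⟨hk, hd, ha, hb⟩

/-- Expansion of a node atom `[ν]` (for `deg ν ≥ 2`): by L1 with `m = deg ν / 2`,
`[ν] = Σ_{μ ∈ F_m, deg μ ≤ deg ν} [ν : μ] · [μ₁] · [μ₂]`.
[cite: Tavenas2015, §5, first case (β a leaf): 3 factors of degree ≤ half] -/
def nodeExp (ν : ι) : List (List (Atom ι)) :=
  (((H.frontier (H.deg ν / 2)).filter fun μ => H.deg μ ≤ H.deg ν).toList).map fun μ =>
    [.quot ν μ, .node (H.children μ).1, .node (H.children μ).2]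

/-- The node expansion sums to the value of the node (Tavenas 2015, §5, first case). [cite:
Tavenas2015, §5 (proof of Prop. 3)] -/
theorem nodeExp_sum {ν : ι} (hν : 2 ≤ H.deg ν) :
    ((H.nodeExp ν).map H.tval).sum = H.val ν := by
  rw [nodeExp, List.map_map, Finset.sum_map_toList, Finset.sum_filter_of_ne,
    H.val_eq_sum_frontier (m := H.deg ν / 2) (by omega) (by omega)]
  · apply Finset.sum_congr rfl
    intro μ hμ
    obtain ⟨hk, -, -, -⟩ := H.of_mem_frontier hμ
    simp [(H.wf_prod μ _ _ hk).2.2.2]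
  · intro μ hμ hne
    by_contra hlt
    apply hne
    simp [H.quot_eq_zero_of_deg_lt' (Nat.lt_of_not_le hlt)]

omit [DecidableEq ι] in
/-- Every term of the node expansion has formal degree `deg ν`. [cite: Tavenas2015, §5 (proof of
Prop. 3)] -/
theorem nodeExp_tdeg {ν : ι} {T : List (Atom ι)} (hT : T ∈ H.nodeExp ν) : H.tdeg T = H.deg ν := by
  simp only [nodeExp, List.mem_map, Finset.mem_toList, Finset.mem_filter] at hT
  obtain ⟨μ, ⟨hμ, hle⟩, rfl⟩ := hT
  obtain ⟨hk, -, -, -⟩ := H.of_mem_frontier hμ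
  have := (H.wf_prod μ _ _ hk).2.2.1
  simp [tdeg]
  omega

omit [DecidableEq ι] in
/-- Every atom of the node expansion has formal degree at most half of `deg ν` (Tavenas 2015, §5,
the three inequalities of the first case). [cite: Tavenas2015, §5 (proof of Prop. 3)] -/
theorem nodeExp_half {ν : ι} {T : List (Atom ι)} (hT : T ∈ H.nodeExp ν) :
    ∀ b ∈ T, 2 * H.adeg b ≤ H.deg ν := by
  simp only [nodeExp, List.mem_map, Finset.mem_toList, Finset.mem_filter] at hT
  obtain ⟨μ, ⟨hμ, hle⟩, rfl⟩ := hT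
  obtain ⟨hk, hd, ha, hb⟩ := H.of_mem_frontier hμ
  intro b hb'
  simp only [List.mem_cons, List.not_mem_nil, or_false] at hb'
  rcases hb' with rfl | rfl | rfl
  · simp; omega
  · simp; omega
  · simp; omega

omit [DecidableEq ι] in
/-- Every term of the node expansion has at most `3` atoms. [cite: Tavenas2015, §5 (proof of Prop.
3)] -/
theorem nodeExp_length_le {ν : ι} {T : List (Atom ι)} (hT : T ∈ H.nodeExp ν) : T.length ≤ 3 := by
  simp only [nodeExp, List.mem_map, Finset.mem_toList, Finset.mem_filter] at hT
  obtain ⟨μ, -, rfl⟩ := hT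
  simp

omit [DecidableEq ι] in
/-- The node expansion has at most `#ι` terms. [cite: Tavenas2015, §5 (proof of Prop. 3)] -/
theorem length_nodeExp_le (ν : ι) : (H.nodeExp ν).length ≤ Fintype.card ι := by
  rw [nodeExp, List.length_map, Finset.length_toList]
  exact Finset.card_le_univ _

/-- The summands of the expansion of `[ν : μ]` indexed by a frontier node `w`.
[cite: Tavenas2015, §5, second case (β not a leaf), eqs. (3)–(5)] -/
def quotExpAux (ν μ w : ι) : List (List (Atom ι)) :=
  if 2 * H.deg (H.light (H.children w).1 (H.children w).2) ≤ H.deg ν - H.deg μ then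
    [[.quot ν w, .node (H.light (H.children w).1 (H.children w).2),
      .quot (H.heavy (H.children w).1 (H.children w).2) μ]]
  else (H.nodeExp (H.light (H.children w).1 (H.children w).2)).map fun mid =>
    .quot ν w :: (mid ++ [.quot (H.heavy (H.children w).1 (H.children w).2) μ])

/-- Expansion of a quotient atom `[ν : μ]` (for `deg ν - deg μ ≥ 2`): by L2 with
`m = (deg ν + deg μ) / 2`, `[ν : μ] = Σ_w [ν : w] · [w_l] · [w_h : μ]`, followed by one node
expansion of `[w_l]` when its degree exceeds half of `deg ν - deg μ` (Tavenas 2015 §5, the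
five-factor case). [cite: Tavenas2015, §5, second case (β not a leaf), eqs. (3)–(5)] -/
def quotExp (ν μ : ι) : List (List (Atom ι)) :=
  (((H.frontier ((H.deg ν + H.deg μ) / 2)).filter fun w =>
      H.deg w ≤ H.deg ν ∧
        H.deg μ ≤ H.deg (H.heavy (H.children w).1 (H.children w).2)).toList).flatMap
    (H.quotExpAux ν μ)

/-- Each summand of the quotient expansion sums to `[ν : w] · [w_l] · [w_h : μ]`. [cite:
Tavenas2015, §5 (proof of Prop. 3)] -/
theorem quotExpAux_sum {ν μ w : ι} (hD : 2 ≤ H.deg ν - H.deg μ) :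
    ((H.quotExpAux ν μ w).map H.tval).sum =
      H.quot ν w * (H.val (H.light (H.children w).1 (H.children w).2) *
        H.quot (H.heavy (H.children w).1 (H.children w).2) μ) := by
  unfold quotExpAux
  split_ifs with h
  · simp
  · rw [List.map_map]
    have h2 : 2 ≤ H.deg (H.light (H.children w).1 (H.children w).2) := by omega
    rw [← H.nodeExp_sum h2, ← List.sum_map_mul_right, ← List.sum_map_mul_left]
    congr 1
    apply List.map_congr_left
    intro mid _
    simp [Function.comp]

/-- The quotient expansion sums to the quotient (Tavenas 2015, §5, eqs. (3) and (5)). [cite: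
Tavenas2015, §5 (proof of Prop. 3)] -/
theorem quotExp_sum {ν μ : ι} (hD : 2 ≤ H.deg ν - H.deg μ) :
    ((H.quotExp ν μ).map H.tval).sum = H.quot ν μ := by
  rw [quotExp, List.flatMap_def, List.map_flatten, List.sum_flatten, List.map_map, List.map_map]
  have hcongr : ∀ L : List ι, L.map ((List.sum ∘ List.map H.tval) ∘ H.quotExpAux ν μ) =
      L.map fun w => H.quot ν w * (H.val (H.light (H.children w).1 (H.children w).2) *
        H.quot (H.heavy (H.children w).1 (H.children w).2) μ) :=
    fun L => List.map_congr_left fun w _ => H.quotExpAux_sum hD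
  rw [hcongr, Finset.sum_map_toList, Finset.sum_filter_of_ne,
    H.quot_eq_sum_frontier (m := (H.deg ν + H.deg μ) / 2) (by omega) (by omega) (by omega)]
  · apply Finset.sum_congr rfl
    intro w hw
    obtain ⟨hk, hd, -, -⟩ := H.of_mem_frontier hw
    have hwμ : w ≠ μ := by rintro rfl; omega
    rw [H.quot_prod hk hwμ]
  · intro w hw hne
    obtain ⟨hk, hd, -, -⟩ := H.of_mem_frontier hw
    have hwμ : w ≠ μ := by rintro rfl; omega
    constructor
    · by_contra hlt
      apply hne
      rw [H.quot_eq_zero_of_deg_lt' (Nat.lt_of_not_le hlt), zero_mul]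
    · by_contra hlt
      apply hne
      rw [H.quot_eq_zero_of_deg_lt' (Nat.lt_of_not_le hlt), mul_zero, mul_zero]

omit [DecidableEq ι] in
/-- Shape of the terms of the quotient expansion: three atoms, or five after one node expansion.
[cite: Tavenas2015, §5 (proof of Prop. 3)] -/
theorem mem_quotExp {ν μ : ι} {T : List (Atom ι)} (hT : T ∈ H.quotExp ν μ) :
    ∃ w, w ∈ H.frontier ((H.deg ν + H.deg μ) / 2) ∧ H.deg w ≤ H.deg ν ∧
      H.deg μ ≤ H.deg (H.heavy (H.children w).1 (H.children w).2) ∧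
      ((2 * H.deg (H.light (H.children w).1 (H.children w).2) ≤ H.deg ν - H.deg μ ∧
        T = [.quot ν w, .node (H.light (H.children w).1 (H.children w).2),
          .quot (H.heavy (H.children w).1 (H.children w).2) μ]) ∨
      (¬ 2 * H.deg (H.light (H.children w).1 (H.children w).2) ≤ H.deg ν - H.deg μ ∧
        ∃ mid ∈ H.nodeExp (H.light (H.children w).1 (H.children w).2),
          T = .quot ν w :: (mid ++ [.quot (H.heavy (H.children w).1 (H.children w).2) μ]))) := by
  simp only [quotExp, List.mem_flatMap, Finset.mem_toList, Finset.mem_filter] at hT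
  obtain ⟨w, ⟨hw, hle, hμ⟩, hT⟩ := hT
  refine ⟨w, hw, hle, hμ, ?_⟩
  unfold quotExpAux at hT
  split_ifs at hT with h
  · left
    simp only [List.mem_singleton] at hT
    exact ⟨h, hT⟩
  · right
    simp only [List.mem_map] at hT
    obtain ⟨mid, hmid, rfl⟩ := hT
    exact ⟨h, mid, hmid, rfl⟩

omit [DecidableEq ι] in
/-- Every term of the quotient expansion has formal degree `deg ν - deg μ`. [cite: Tavenas2015, §5
(proof of Prop. 3)] -/
theorem quotExp_tdeg {ν μ : ι} {T : List (Atom ι)} (hT : T ∈ H.quotExp ν μ) :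
    H.tdeg T = H.deg ν - H.deg μ := by
  obtain ⟨w, hw, hle, hμ, h⟩ := H.mem_quotExp hT
  obtain ⟨hk, hd, ha, hb⟩ := H.of_mem_frontier hw
  have hdw := H.deg_prod_eq hk
  rcases h with ⟨h2, rfl⟩ | ⟨h2, mid, hmid, rfl⟩
  · simp [tdeg]
    omega
  · have := H.nodeExp_tdeg hmid
    simp only [tdeg_cons, tdeg_append, adeg_quot, this, tdeg_nil, add_zero]
    omega

omit [DecidableEq ι] in
/-- Every atom of the quotient expansion has formal degree at most half of `deg ν - deg μ` (Tavenas
2015, §5, the degree inequalities of the second case). [cite: Tavenas2015, §5 (proof of Prop. 3)] -/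
theorem quotExp_half {ν μ : ι} {T : List (Atom ι)} (hT : T ∈ H.quotExp ν μ) :
    ∀ b ∈ T, 2 * H.adeg b ≤ H.deg ν - H.deg μ := by
  obtain ⟨w, hw, hle, hμ, h⟩ := H.mem_quotExp hT
  obtain ⟨hk, hd, ha, hb⟩ := H.of_mem_frontier hw
  have hdw := H.deg_prod_eq hk
  have hh := H.deg_heavy_le_of ha hb
  rcases h with ⟨h2, rfl⟩ | ⟨h2, mid, hmid, rfl⟩
  · intro b hb'
    simp only [List.mem_cons, List.not_mem_nil, or_false] at hb'
    rcases hb' with rfl | rfl | rfl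
    · simp; omega
    · simpa using h2
    · simp; omega
  · intro b hb'
    simp only [List.mem_cons, List.mem_append, List.not_mem_nil, or_false] at hb'
    rcases hb' with rfl | hb' | rfl
    · simp; omega
    · have := H.nodeExp_half hmid b hb'
      omega
    · simp; omega

omit [DecidableEq ι] in
/-- Every term of the quotient expansion has at most `5` atoms (the fan-in `5` of ×-balanced
circuits, Tavenas 2015, Def. 4). [cite: Tavenas2015, §4 Def. 4 and §5] -/
theorem quotExp_length_le {ν μ : ι} {T : List (Atom ι)} (hT : T ∈ H.quotExp ν μ) :
    T.length ≤ 5 := by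
  obtain ⟨w, hw, hle, hμ, h⟩ := H.mem_quotExp hT
  rcases h with ⟨h2, rfl⟩ | ⟨h2, mid, hmid, rfl⟩
  · simp
  · have := H.nodeExp_length_le hmid
    simp
    omega

omit [DecidableEq ι] in
/-- The quotient expansion has at most `#ι²` terms (Tavenas 2015, §5: size `s⁴ + 1`, coarsened).
[cite: Tavenas2015, §5 (proof of Prop. 3)] -/
theorem length_quotExp_le (ν μ : ι) :
    (H.quotExp ν μ).length ≤ Fintype.card ι * Fintype.card ι := by
  rw [quotExp, List.length_flatMap]
  refine (List.sum_le_card_nsmul _ (Fintype.card ι) ?_).trans ?_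
  · intro x hx
    simp only [List.mem_map] at hx
    obtain ⟨w, -, rfl⟩ := hx
    unfold quotExpAux
    split_ifs
    · simpa using Nat.succ_le_of_lt (Fintype.card_pos_iff.2 ⟨ν⟩)
    · simpa using H.length_nodeExp_le _
  · rw [List.length_map, Finset.length_toList, smul_eq_mul]
    exact Nat.mul_le_mul_right _ (Finset.card_le_univ _)

/-- Expansion of an atom of formal degree `≥ 2`.
[cite: Tavenas2015, §5, Prop. 3 (×-balanced circuit)] -/
def expandAtom : Atom ι → List (List (Atom ι))
  | .node ν => H.nodeExp ν
  | .quot ν μ => H.quotExp ν μ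

/-- The expansion of an atom sums to its value. [cite: Tavenas2015, §5 (proof of Prop. 3)] -/
theorem expandAtom_sum {a : Atom ι} (ha : 2 ≤ H.adeg a) :
    ((H.expandAtom a).map H.tval).sum = H.aval a := by
  cases a with
  | node ν => exact H.nodeExp_sum ha
  | quot ν μ => exact H.quotExp_sum ha

omit [DecidableEq ι] in
/-- Every term of the expansion of an atom has the formal degree of the atom (homogeneity). [cite:
Tavenas2015, §5 (proof of Prop. 3)] -/
theorem expandAtom_tdeg {a : Atom ι} {T : List (Atom ι)} (hT : T ∈ H.expandAtom a) :
    H.tdeg T = H.adeg a := by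
  cases a with
  | node ν => exact H.nodeExp_tdeg hT
  | quot ν μ => exact H.quotExp_tdeg hT

omit [DecidableEq ι] in
/-- ×-balance: every atom of the expansion has formal degree at most half of the expanded atom
(Tavenas 2015, Def. 4 / Prop. 3). [cite: Tavenas2015, §4 Def. 4, §5 Prop. 3] -/
theorem expandAtom_half {a : Atom ι} {T : List (Atom ι)} (hT : T ∈ H.expandAtom a) :
    ∀ b ∈ T, 2 * H.adeg b ≤ H.adeg a := by
  cases a with
  | node ν => exact H.nodeExp_half hT
  | quot ν μ => exact H.quotExp_half hT

omit [DecidableEq ι] in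
/-- Every term of the expansion has at most `5` atoms (Tavenas 2015, Def. 4). [cite: Tavenas2015, §4
Def. 4] -/
theorem expandAtom_length_le {a : Atom ι} {T : List (Atom ι)} (hT : T ∈ H.expandAtom a) :
    T.length ≤ 5 := by
  cases a with
  | node ν => exact (H.nodeExp_length_le hT).trans (by norm_num)
  | quot ν μ => exact H.quotExp_length_le hT

omit [DecidableEq ι] in
/-- The expansion of an atom has at most `#ι²` terms. [cite: Tavenas2015, §5 (proof of Prop. 3)] -/
theorem length_expandAtom_le (a : Atom ι) :
    (H.expandAtom a).length ≤ Fintype.card ι * Fintype.card ι := by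
  cases a with
  | node ν =>
    refine (H.length_nodeExp_le ν).trans ?_
    exact Nat.le_mul_of_pos_left _ (Fintype.card_pos_iff.2 ⟨ν⟩)
  | quot ν μ => exact H.length_quotExp_le ν μ

end Expansion


/-! ## Iterating the expansion (Agrawal–Vinay; Tavenas 2015, §6) -/

section Rounds

variable [Fintype ι]

/-- Sum of a `flatMap` is the sum of the sums. [folklore] -/
theorem _root_.Literature.Computability.AlgebraicComplexity.DepthReduction.sum_flatMap {α M : Type*} [AddMonoid M] (l : List α)
    (f : α → List M) : (l.flatMap f).sum = (l.map fun a => (f a).sum).sum := by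
  rw [List.flatMap_def, List.sum_flatten, List.map_map]
  rfl

/-- Big/small accounting: a list of `≤ 5` naturals summing to `D > t`, each at most `D / 2`,
has at least two entries `> t / 8`.
[cite: Tavenas2015, §6 (proof of Lemma 3, counting of 𝒢₁); AgrawalVinay2008] -/
theorem _root_.Literature.Computability.AlgebraicComplexity.DepthReduction.two_le_countP {L : List ℕ} {D t : ℕ}
    (hlen : L.length ≤ 5) (hsum : L.sum = D) (hhalf : ∀ e ∈ L, 2 * e ≤ D) (ht : t < D) :
    2 ≤ L.countP (fun e => t < 8 * e) := by
  have hsplit : ∀ L : List ℕ, L.sum = (L.filter fun e => t < 8 * e).sum +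
      (L.filter fun e => 8 * e ≤ t).sum ∧
      L.length = (L.filter fun e => t < 8 * e).length +
      (L.filter fun e => 8 * e ≤ t).length := by
    intro L
    induction L with
    | nil => simp
    | cons e L ih =>
      by_cases h : t < 8 * e
      · have h' : ¬ 8 * e ≤ t := by omega
        simp [h, h', ih.1, ih.2]; omega
      · have h' : 8 * e ≤ t := by omega
        simp [h, h', ih.1, ih.2]; omega
  have hsmall : ∀ l : List ℕ, (∀ e ∈ l, 8 * e ≤ t) → 8 * l.sum ≤ t * l.length := by
    intro l hl
    induction l with
    | nil => simp
    | cons e l ih =>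
      rw [List.sum_cons, List.length_cons, Nat.mul_add, Nat.mul_succ]
      have := hl e (by simp)
      have := ih fun e he => hl e (by simp [he])
      omega
  obtain ⟨hs, hl⟩ := hsplit L
  set big := L.filter fun e => t < 8 * e with hbig
  set small := L.filter fun e => 8 * e ≤ t with hsmall_def
  have hsmall_sum : 8 * small.sum ≤ t * small.length := hsmall small (by
    intro e he
    rw [hsmall_def, List.mem_filter] at he
    simpa using he.2)
  rw [List.countP_eq_length_filter, ← hbig]
  by_contra hlt
  obtain hb | hb : big.length = 0 ∨ big.length = 1 := by omega
  · have hb0 : big.sum = 0 := by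
      rw [List.length_eq_zero_iff] at hb; rw [hb]; rfl
    have h5 : t * small.length ≤ t * 5 := Nat.mul_le_mul_left _ (by omega)
    omega
  · obtain ⟨e, he⟩ := List.length_eq_one_iff.1 hb
    have hbe : big.sum = e := by rw [he]; simp
    have h2e : 2 * e ≤ D := hhalf e (by
      have : e ∈ big := by rw [he]; simp
      rw [hbig, List.mem_filter] at this
      exact this.1)
    have h4 : t * small.length ≤ t * 4 := Nat.mul_le_mul_left _ (by omega)
    omega

variable (t : ℕ)

/-- Split a term at its first atom of formal degree `> t`. [cite: AgrawalVinay2008] -/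
def split : List (Atom ι) → Option (List (Atom ι) × Atom ι × List (Atom ι))
  | [] => none
  | a :: T => if t < H.adeg a then some ([], a, T)
      else (split T).map fun p => (a :: p.1, p.2.1, p.2.2)

omit [DecidableEq ι] [Fintype ι] in
/-- If `split` finds nothing, all atoms have formal degree `≤ t`. [folklore] -/
theorem split_none {T : List (Atom ι)} (h : H.split t T = none) : ∀ a ∈ T, H.adeg a ≤ t := by
  induction T with
  | nil => simp
  | cons a T ih =>
    simp only [split] at h
    split_ifs at h with hlt
    rw [Option.map_eq_none_iff] at h
    intro b hb
    rcases List.mem_cons.1 hb with rfl | hb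
    · exact Nat.le_of_not_lt hlt
    · exact ih h b hb

omit [DecidableEq ι] [Fintype ι] in
/-- If `split` finds an atom, the term decomposes around an atom of formal degree `> t`. [folklore]
-/
theorem split_some {T p s : List (Atom ι)} {a : Atom ι} (h : H.split t T = some (p, a, s)) :
    T = p ++ a :: s ∧ t < H.adeg a := by
  induction T generalizing p with
  | nil => simp [split] at h
  | cons b T ih =>
    simp only [split] at h
    split_ifs at h with hlt
    · simp only [Option.some.injEq, Prod.mk.injEq] at h
      obtain ⟨rfl, rfl, rfl⟩ := h
      exact ⟨rfl, hlt⟩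
    · rw [Option.map_eq_some_iff] at h
      obtain ⟨⟨p', a', s'⟩, h1, h2⟩ := h
      simp only [Prod.mk.injEq] at h2
      obtain ⟨rfl, rfl, rfl⟩ := h2
      obtain ⟨h3, h4⟩ := ih h1
      exact ⟨by rw [h3]; rfl, h4⟩

/-- One round on one term: expand its first atom of formal degree `> t` (if any).
[cite: Tavenas2015, §6; AgrawalVinay2008] -/
def round1 (T : List (Atom ι)) : List (List (Atom ι)) :=
  match H.split t T with
  | none => [T]
  | some (p, a, s) => (H.expandAtom a).map fun mid => p ++ mid ++ s

/-- One round on a list of terms. [cite: Tavenas2015, §6; AgrawalVinay2008] -/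
def roundAll (L : List (List (Atom ι))) : List (List (Atom ι)) := L.flatMap (H.round1 t)

/-- The full expansion: `R` rounds starting from the single term `[[ν]]`.
[cite: Tavenas2015, §6; AgrawalVinay2008] -/
def expand (ν : ι) (R : ℕ) : List (List (Atom ι)) := (H.roundAll t)^[R] [[.node ν]]

/-- A term is final if all its atoms have formal degree `≤ t`.
[cite: Tavenas2015, §6 (the cut at degree d/a)] -/
def Final (T : List (Atom ι)) : Prop := ∀ a ∈ T, H.adeg a ≤ t

/-- The potential: number of atoms of formal degree `> t / 8`.
[cite: Tavenas2015, §6 (proof of Lemma 3); AgrawalVinay2008] -/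
def bigCount (T : List (Atom ι)) : ℕ := T.countP fun a => t < 8 * H.adeg a

omit [DecidableEq ι] [Fintype ι] in
/-- The potential is additive under concatenation. [folklore] -/
@[simp] theorem bigCount_append (T T' : List (Atom ι)) :
    H.bigCount t (T ++ T') = H.bigCount t T + H.bigCount t T' := by
  simp [bigCount, List.countP_append]

omit [DecidableEq ι] [Fintype ι] in
/-- The potential of a cons. [folklore] -/
@[simp] theorem bigCount_cons (a : Atom ι) (T : List (Atom ι)) :
    H.bigCount t (a :: T) = H.bigCount t T + if t < 8 * H.adeg a then 1 else 0 := by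
  simp [bigCount, List.countP_cons]

omit [DecidableEq ι] [Fintype ι] in
/-- The potential is at most `8 · (formal degree) / (t + 1)`: atoms counted have `8 · deg ≥ t + 1`.
[cite: Tavenas2015, §6 (proof of Lemma 3: |𝒢₀| ≤ a)] -/
theorem bigCount_mul_le (T : List (Atom ι)) : H.bigCount t T * (t + 1) ≤ 8 * H.tdeg T := by
  induction T with
  | nil => simp [bigCount]
  | cons a T ih =>
    rw [bigCount_cons, tdeg_cons]
    split_ifs with h
    · rw [Nat.add_mul, one_mul]; omega
    · rw [Nat.add_zero]; omega

/-- The invariant after `r` rounds. [cite: Tavenas2015, §6; AgrawalVinay2008] -/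
structure Inv (v : MvPolynomial σ k) (D r : ℕ) (L : List (List (Atom ι))) : Prop where
  sum_eq : (L.map H.tval).sum = v
  tdeg_le : ∀ T ∈ L, H.tdeg T ≤ D
  length_le : ∀ T ∈ L, T.length ≤ 1 + 4 * r
  card_le : L.length ≤ (Fintype.card ι * Fintype.card ι) ^ r
  final_or : ∀ T ∈ L, H.Final t T ∨ r + 1 ≤ H.bigCount t T

/-- The invariant holds initially for the single term `[[ν]]`. [folklore] -/
theorem inv_zero (ν : ι) : H.Inv t (H.val ν) (H.deg ν) 0 [[.node ν]] where
  sum_eq := by simp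
  tdeg_le := by simp [tdeg]
  length_le := by simp
  card_le := by simp
  final_or := by
    intro T hT
    simp only [List.mem_singleton] at hT
    subst hT
    by_cases h : H.deg ν ≤ t
    · left; intro a ha; simp only [List.mem_singleton] at ha; subst ha; simpa using h
    · right
      have h8 : t < 8 * H.deg ν := by omega
      simp [bigCount, h8]

variable {t}

omit [DecidableEq ι] in
/-- Shape of the terms produced by one round on one term. [folklore] -/
theorem mem_round1 {T T' : List (Atom ι)} (h : T' ∈ H.round1 t T) :
    (H.split t T = none ∧ T' = T) ∨ ∃ p a s mid, H.split t T = some (p, a, s) ∧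
      mid ∈ H.expandAtom a ∧ T' = p ++ mid ++ s := by
  unfold round1 at h
  split at h
  · next hs => left; exact ⟨hs, List.mem_singleton.1 h⟩
  · next p a s hs =>
    right
    obtain ⟨mid, hmid, rfl⟩ := List.mem_map.1 h
    exact ⟨p, a, s, mid, hs, hmid, rfl⟩

/-- One round on one term preserves the value. [cite: AgrawalVinay2008] -/
theorem round1_sum (ht : 1 ≤ t) (T : List (Atom ι)) :
    ((H.round1 t T).map H.tval).sum = H.tval T := by
  unfold round1
  split
  · simp
  · next p a s hs =>
    obtain ⟨rfl, hlt⟩ := H.split_some t hs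
    rw [List.map_map]
    have : (List.map (H.tval ∘ fun mid => p ++ mid ++ s) (H.expandAtom a)) =
        (H.expandAtom a).map fun mid => H.tval p * H.tval mid * H.tval s := by
      apply List.map_congr_left; intro mid _; simp [mul_assoc]
    rw [this, List.sum_map_mul_right, List.sum_map_mul_left, H.expandAtom_sum (by omega)]
    simp [mul_assoc]

omit [DecidableEq ι] in
/-- One round on one term produces at most `#ι²` terms. [cite: AgrawalVinay2008] -/
theorem length_round1_le [Nonempty ι] (T : List (Atom ι)) :
    (H.round1 t T).length ≤ Fintype.card ι * Fintype.card ι := by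
  unfold round1
  split
  · simpa using Nat.mul_le_mul (Nat.succ_le_of_lt (Fintype.card_pos (α := ι)))
      (Nat.succ_le_of_lt (Fintype.card_pos (α := ι)))
  · rw [List.length_map]; exact H.length_expandAtom_le _

/-- One round preserves the invariant and raises the potential of every non-final term
(Agrawal–Vinay expansion; Tavenas 2015 §6 counting). [cite: Tavenas2015, §6; AgrawalVinay2008] -/
theorem inv_succ [Nonempty ι] (ht : 1 ≤ t) {v : MvPolynomial σ k} {D r : ℕ}
    {L : List (List (Atom ι))} (hL : H.Inv t v D r L) : H.Inv t v D (r + 1) (H.roundAll t L) where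
  sum_eq := by
    rw [roundAll, List.map_flatMap, sum_flatMap, ← hL.sum_eq]
    congr 1
    apply List.map_congr_left
    intro T _
    exact H.round1_sum ht T
  tdeg_le := by
    intro T' hT'
    obtain ⟨T, hT, hT'⟩ := List.mem_flatMap.1 hT'
    rcases H.mem_round1 hT' with ⟨-, rfl⟩ | ⟨p, a, s, mid, hs, hmid, rfl⟩
    · exact hL.tdeg_le _ hT
    · obtain ⟨rfl, hlt⟩ := H.split_some t hs
      have := hL.tdeg_le _ hT
      simp only [tdeg_append, tdeg_cons] at this ⊢
      rw [H.expandAtom_tdeg hmid]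
      omega
  length_le := by
    intro T' hT'
    obtain ⟨T, hT, hT'⟩ := List.mem_flatMap.1 hT'
    rcases H.mem_round1 hT' with ⟨-, rfl⟩ | ⟨p, a, s, mid, hs, hmid, rfl⟩
    · exact (hL.length_le _ hT).trans (by omega)
    · obtain ⟨rfl, hlt⟩ := H.split_some t hs
      have h1 := hL.length_le _ hT
      have h2 := H.expandAtom_length_le hmid
      simp only [List.length_append, List.length_cons] at h1 ⊢
      omega
  card_le := by
    rw [roundAll, List.length_flatMap, pow_succ]
    refine (List.sum_le_card_nsmul _ (Fintype.card ι * Fintype.card ι) ?_).trans ?_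
    · intro x hx
      obtain ⟨T, -, rfl⟩ := List.mem_map.1 hx
      exact H.length_round1_le T
    · rw [List.length_map, smul_eq_mul]
      exact Nat.mul_le_mul_right _ hL.card_le
  final_or := by
    intro T' hT'
    obtain ⟨T, hT, hT'⟩ := List.mem_flatMap.1 hT'
    rcases H.mem_round1 hT' with ⟨hs, rfl⟩ | ⟨p, a, s, mid, hs, hmid, rfl⟩
    · left; exact H.split_none t hs
    · right
      obtain ⟨rfl, hlt⟩ := H.split_some t hs
      have hnf : ¬ H.Final t (p ++ a :: s) := fun hf => by
        have := hf a (by simp); omega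
      have hc := (hL.final_or _ hT).resolve_left hnf
      have hmid2 : 2 ≤ H.bigCount t mid := by
        have h2 := two_le_countP (t := t)
          ((List.length_map _).trans_le (H.expandAtom_length_le hmid))
          (H.expandAtom_tdeg hmid) (fun e he => by
            obtain ⟨b, hb, rfl⟩ := List.mem_map.1 he
            exact H.expandAtom_half hmid b hb) hlt
        rw [List.countP_map] at h2
        exact h2
      have h8 : t < 8 * H.adeg a := by omega
      simp only [bigCount_append, bigCount_cons, h8, if_true] at hc ⊢
      omega

/-- The invariant after `R` rounds. [cite: Tavenas2015, §6; AgrawalVinay2008] -/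
theorem inv_expand [Nonempty ι] (ht : 1 ≤ t) (ν : ι) (R : ℕ) :
    H.Inv t (H.val ν) (H.deg ν) R (H.expand t ν R) := by
  induction R with
  | zero => exact H.inv_zero t ν
  | succ R ih =>
    rw [expand, Function.iterate_succ_apply']
    exact H.inv_succ ht ih

/-- After `R = 8 · deg ν / (t + 1)` rounds every atom has formal degree `≤ t`.
[cite: Tavenas2015, §6, Lemma 3 (degree of C₂ ≤ 15a); AgrawalVinay2008] -/
theorem final_expand [Nonempty ι] (ht : 1 ≤ t) (ν : ι) :
    ∀ T ∈ H.expand t ν (8 * H.deg ν / (t + 1)), H.Final t T := by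
  intro T hT
  have hinv := H.inv_expand ht ν (8 * H.deg ν / (t + 1))
  refine (hinv.final_or T hT).resolve_right fun hc => ?_
  have h1 := H.bigCount_mul_le t T
  have h2 := hinv.tdeg_le T hT
  have h3 : 8 * H.deg ν < (8 * H.deg ν / (t + 1) + 1) * (t + 1) := by
    rw [Nat.add_mul, one_mul]
    exact Nat.lt_div_mul_add (by omega)
  have h4 : (8 * H.deg ν / (t + 1) + 1) * (t + 1) ≤ H.bigCount t T * (t + 1) :=
    Nat.mul_le_mul_right _ hc
  omega

/-- **The iterated expansion.** For a node `ν` of a homogeneous circuit certificate on a finite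
node type of cardinality `S` and a threshold `t ≥ 1`, with `R = 8 · deg ν / (t + 1)`: `val ν` is
a sum of at most `(S²)^R` products of at most `1 + 4R` polynomials of total degree `≤ t` each
(Tavenas 2015, Thm. 1 / Lemma 3, in the Agrawal–Vinay expansion form).
[cite: Tavenas2015, Thm. 1 and Lemma 3; AgrawalVinay2008] -/
theorem exists_sum_prod (ht : 1 ≤ t) (ν : ι) :
    ∃ L : List (List (MvPolynomial σ k)),
      (L.map List.prod).sum = H.val ν ∧
      L.length ≤ (Fintype.card ι * Fintype.card ι) ^ (8 * H.deg ν / (t + 1)) ∧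
      ∀ T ∈ L, T.length ≤ 1 + 4 * (8 * H.deg ν / (t + 1)) ∧ ∀ p ∈ T, p.totalDegree ≤ t := by
  haveI : Nonempty ι := ⟨ν⟩
  have hinv := H.inv_expand ht ν (8 * H.deg ν / (t + 1))
  refine ⟨(H.expand t ν (8 * H.deg ν / (t + 1))).map (List.map H.aval), ?_, ?_, ?_⟩
  · rw [← hinv.sum_eq, List.map_map]
    rfl
  · rw [List.length_map]; exact hinv.card_le
  · intro T' hT'
    obtain ⟨T, hT, rfl⟩ := List.mem_map.1 hT'
    refine ⟨(List.length_map _).trans_le (hinv.length_le T hT), ?_⟩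
    intro p hp
    obtain ⟨a, ha, rfl⟩ := List.mem_map.1 hp
    exact (H.totalDegree_aval_le a).trans (H.final_expand ht ν T hT a ha)

end Rounds


end Quot

end HomCircuit

/-! ## Straight-line programs and homogenization (Tavenas 2015, Prop. 2) -/

section SLP

variable {k : Type u} [CommSemiring k] {σ : Type v}

/-- Homogeneous components of a product (Cauchy product formula). [folklore] -/
theorem homogeneousComponent_mul (n : ℕ) (φ ψ : MvPolynomial σ k) :
    homogeneousComponent n (φ * ψ) =
      ∑ i ∈ Finset.range (n + 1), homogeneousComponent i φ * homogeneousComponent (n - i) ψ := by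
  classical
  ext m
  rw [coeff_homogeneousComponent, coeff_sum]
  simp_rw [coeff_mul, coeff_homogeneousComponent]
  rw [Finset.sum_comm]
  split_ifs with hm
  · apply Finset.sum_congr rfl
    rintro ⟨p, q⟩ hpq
    rw [Finset.mem_antidiagonal] at hpq
    have hdeg : p.degree + q.degree = n := by rw [← map_add, hpq, hm]
    rw [Finset.sum_eq_single p.degree]
    · simp [show n - p.degree = q.degree by omega]
    · intro i _ hne
      simp [Ne.symm hne]
    · intro h
      simp at h
      omega
  · symm
    apply Finset.sum_eq_zero
    rintro ⟨p, q⟩ hpq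
    apply Finset.sum_eq_zero
    intro i hi
    rw [Finset.mem_antidiagonal] at hpq
    simp only [Finset.mem_range] at hi
    split_ifs with h1 h2 <;> simp
    exfalso; apply hm
    rw [← hpq, map_add]
    omega


/-- Operand of a line of a straight-line program: a variable, a constant, or a reference to the
value of an earlier line (junk value `0` if not earlier). [cite: Burgisser2000, Def. 2.1] -/
inductive SOperand (k : Type u) (σ : Type v) : Type (max u v)
  | var (j : σ) : SOperand k σ
  | const (c : k) : SOperand k σ
  | ref (j : ℕ) : SOperand k σ

/-- A line of a straight-line program: a linear combination `a • u + b • v` or a product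
`u * v` of two operands (fan-in two; Bürgisser 2000, Def. 2.1). [cite: Burgisser2000, Def. 2.1] -/
inductive SLine (k : Type u) (σ : Type v) : Type (max u v)
  | lin (a : k) (u : SOperand k σ) (b : k) (v : SOperand k σ) : SLine k σ
  | mul (u v : SOperand k σ) : SLine k σ

/-- Value of an operand at line `i`, given the values of all lines.
[cite: Burgisser2000, Def. 2.1] -/
def SOperand.evalAt (val : ℕ → MvPolynomial σ k) (i : ℕ) : SOperand k σ → MvPolynomial σ k
  | .var j => X j
  | .const c => C c
  | .ref j => if j < i then val j else 0

/-- Value of a line at position `i`, given the values of all lines.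
[cite: Burgisser2000, Def. 2.1] -/
def SLine.evalAt (val : ℕ → MvPolynomial σ k) (i : ℕ) : SLine k σ → MvPolynomial σ k
  | .lin a u b v => a • u.evalAt val i + b • v.evalAt val i
  | .mul u v => u.evalAt val i * v.evalAt val i

/-- The first operand of a line. [cite: Burgisser2000, Def. 2.1] -/
def SLine.fst : SLine k σ → SOperand k σ
  | .lin _ u _ _ => u
  | .mul u _ => u

/-- The second operand of a line. [cite: Burgisser2000, Def. 2.1] -/
def SLine.snd : SLine k σ → SOperand k σ
  | .lin _ _ _ v => v
  | .mul _ v => v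

/-- A *straight-line program certificate*: `len` lines, their values, and the local equations
(Bürgisser 2000, Def. 2.1). [cite: Burgisser2000, Def. 2.1] -/
structure SLP (k : Type u) (σ : Type v) [CommSemiring k] where
  /-- number of lines -/
  len : ℕ
  /-- the lines -/
  line : ℕ → SLine k σ
  /-- the values of the lines -/
  val : ℕ → MvPolynomial σ k
  val_eq : ∀ i < len, val i = (line i).evalAt val i

namespace SLP

variable (P : SLP k σ) (d : ℕ)

/-- Tags of the nodes of the homogenized circuit attached to one line: degree-`e` components of
the two operands (`U e`, `V e`), the products `R e a = U a * V (e - a)`, and the degree-`e`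
component of the line itself (`Q e`). [cite: Tavenas2015, §4, Prop. 2] -/
inductive Tag (d : ℕ) : Type
  | U (e : Fin (d + 1)) : Tag d
  | V (e : Fin (d + 1)) : Tag d
  | R (e a : Fin (d + 1)) : Tag d
  | Q (e : Fin (d + 1)) : Tag d
  deriving DecidableEq, Fintype

/-- Node type of the homogenized circuit. [cite: Tavenas2015, §4, Prop. 2] -/
abbrev Node := Fin P.len × Tag d

/-- Value of an operand at line `i`. [cite: Burgisser2000, Def. 2.1] -/
def opVal (i : ℕ) (u : SOperand k σ) : MvPolynomial σ k := u.evalAt P.val i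

/-- Kind of the node holding the degree-`e` component of operand `u` at line `i`.
[cite: Tavenas2015, §4, Prop. 2] -/
def opKind (i : Fin P.len) (e : Fin (d + 1)) : SOperand k σ → HKind k σ (P.Node d)
  | .var j => if e.val = 1 then .var j else .sum []
  | .const c => if e.val = 0 then .const c else .sum []
  | .ref j => if h : j < i.val then .sum [(1, (⟨j, h.trans i.isLt⟩, .Q e))] else .sum []

/-- Rank of a node. [cite: Tavenas2015, §4, Prop. 2] -/
def hrank : P.Node d → ℕ
  | (i, .U _) => 3 * i.val
  | (i, .V _) => 3 * i.val
  | (i, .R _ _) => 3 * i.val + 1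
  | (i, .Q _) => 3 * i.val + 2

/-- Formal degree of a node. [cite: Tavenas2015, §4, Prop. 2] -/
def hdeg : P.Node d → ℕ
  | (_, .U e) => e.val
  | (_, .V e) => e.val
  | (_, .R e _) => e.val
  | (_, .Q e) => e.val

/-- Value of a node. [cite: Tavenas2015, §4, Prop. 2] -/
def hval : P.Node d → MvPolynomial σ k
  | (i, .U e) => homogeneousComponent e.val (P.opVal i.val (P.line i.val).fst)
  | (i, .V e) => homogeneousComponent e.val (P.opVal i.val (P.line i.val).snd)
  | (i, .R e a) => if a.val ≤ e.val then
      homogeneousComponent a.val (P.opVal i.val (P.line i.val).fst) *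
        homogeneousComponent (e.val - a.val) (P.opVal i.val (P.line i.val).snd) else 0
  | (i, .Q e) => homogeneousComponent e.val (P.val i.val)

/-- Value of a `U` node, unfolded. [cite: Tavenas2015, §4, Prop. 2] -/
@[simp] theorem hval_U (i : Fin P.len) (e : Fin (d + 1)) :
    P.hval d (i, .U e) = homogeneousComponent e.val (P.opVal i.val (P.line i.val).fst) := rfl
/-- Value of a `V` node, unfolded. [cite: Tavenas2015, §4, Prop. 2] -/
@[simp] theorem hval_V (i : Fin P.len) (e : Fin (d + 1)) :
    P.hval d (i, .V e) = homogeneousComponent e.val (P.opVal i.val (P.line i.val).snd) := rfl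
/-- Value of an `R` node, unfolded. [cite: Tavenas2015, §4, Prop. 2] -/
@[simp] theorem hval_R (i : Fin P.len) (e a : Fin (d + 1)) :
    P.hval d (i, .R e a) = if a.val ≤ e.val then
      homogeneousComponent a.val (P.opVal i.val (P.line i.val).fst) *
        homogeneousComponent (e.val - a.val) (P.opVal i.val (P.line i.val).snd) else 0 := rfl
/-- Value of a `Q` node, unfolded. [cite: Tavenas2015, §4, Prop. 2] -/
@[simp] theorem hval_Q (i : Fin P.len) (e : Fin (d + 1)) :
    P.hval d (i, .Q e) = homogeneousComponent e.val (P.val i.val) := rfl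

/-- `e - a` in `Fin (d + 1)`. [folklore] -/
def finSub (e a : Fin (d + 1)) : Fin (d + 1) := ⟨e.val - a.val, by omega⟩

/-- Kind of a node. [cite: Tavenas2015, §4, Prop. 2] -/
def hkind : P.Node d → HKind k σ (P.Node d)
  | (i, .U e) => P.opKind d i e (P.line i.val).fst
  | (i, .V e) => P.opKind d i e (P.line i.val).snd
  | (i, .R e a) => if a.val ≤ e.val then .prod (i, .U a) (i, .V (finSub d e a)) else .sum []
  | (i, .Q e) => match P.line i.val with
    | .lin a _ b _ => .sum [(a, (i, .U e)), (b, (i, .V e))]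
    | .mul _ _ => .sum ((List.finRange (d + 1)).map fun a => (1, (i, .R e a)))

/-- Homogeneous components of a variable operand. [folklore] -/
theorem homogeneousComponent_opVal_var (i : ℕ) (j : σ) (e : ℕ) :
    homogeneousComponent e (P.opVal i (.var j)) = if e = 1 then X j else 0 := by
  simp only [opVal, SOperand.evalAt]
  rw [homogeneousComponent_of_mem (isHomogeneous_X k j)]

/-- Homogeneous components of a constant operand. [folklore] -/
theorem homogeneousComponent_opVal_const (i : ℕ) (c : k) (e : ℕ) :
    homogeneousComponent e (P.opVal i (.const c)) = if e = 0 then C c else 0 := by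
  simp only [opVal, SOperand.evalAt]
  rw [homogeneousComponent_of_mem (isHomogeneous_C σ c)]

/-- An operand node of kind `var` is the degree-`1` component of a variable operand. [cite:
Tavenas2015, §4, Prop. 2] -/
theorem opKind_var {i : Fin P.len} {e : Fin (d + 1)} {u : SOperand k σ} {j : σ}
    (h : P.opKind d i e u = .var j) :
    homogeneousComponent e.val (P.opVal i.val u) = X j ∧ e.val = 1 := by
  cases u with
  | var j' =>
    simp only [opKind] at h
    split_ifs at h with he
    cases h
    exact ⟨by rw [homogeneousComponent_opVal_var, if_pos he], he⟩
  | const c => simp only [opKind] at h; split_ifs at h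
  | ref j' => simp only [opKind] at h; split_ifs at h

/-- An operand node of kind `const` is the degree-`0` component of a constant operand. [cite:
Tavenas2015, §4, Prop. 2] -/
theorem opKind_const {i : Fin P.len} {e : Fin (d + 1)} {u : SOperand k σ} {c : k}
    (h : P.opKind d i e u = .const c) :
    homogeneousComponent e.val (P.opVal i.val u) = C c ∧ e.val = 0 := by
  cases u with
  | var j' => simp only [opKind] at h; split_ifs at h
  | const c' =>
    simp only [opKind] at h
    split_ifs at h with he
    cases h
    exact ⟨by rw [homogeneousComponent_opVal_const, if_pos he], he⟩
  | ref j' => simp only [opKind] at h; split_ifs at h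

/-- An operand node of kind `sum` satisfies the local sum equation (a copy of an earlier `Q` node,
or zero). [cite: Tavenas2015, §4, Prop. 2] -/
theorem opKind_sum {i : Fin P.len} {e : Fin (d + 1)} {u : SOperand k σ}
    {args : List (k × P.Node d)} (h : P.opKind d i e u = .sum args) :
    (∀ a ∈ args, P.hrank d a.2 < 3 * i.val ∧ P.hdeg d a.2 = e.val) ∧
      homogeneousComponent e.val (P.opVal i.val u) =
        (args.map fun a => a.1 • P.hval d a.2).sum := by
  cases u with
  | var j' =>
    simp only [opKind] at h
    split_ifs at h with he
    cases h
    exact ⟨by simp, by rw [homogeneousComponent_opVal_var, if_neg he]; rfl⟩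
  | const c' =>
    simp only [opKind] at h
    split_ifs at h with he
    cases h
    exact ⟨by simp, by rw [homogeneousComponent_opVal_const, if_neg he]; rfl⟩
  | ref j' =>
    simp only [opKind] at h
    split_ifs at h with hj
    · cases h
      refine ⟨?_, ?_⟩
      · intro a ha
        simp only [List.mem_singleton] at ha
        subst ha
        exact ⟨by simp only [hrank]; omega, rfl⟩
      · simp [opVal, SOperand.evalAt, hj, hval]
    · cases h
      exact ⟨by simp, by simp [opVal, SOperand.evalAt, hj]⟩

/-- Operand nodes are never product nodes. [cite: Tavenas2015, §4, Prop. 2] -/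
theorem opKind_ne_prod {i : Fin P.len} {e : Fin (d + 1)} {u : SOperand k σ} {a b : P.Node d}
    (h : P.opKind d i e u = .prod a b) : False := by
  cases u <;> simp only [opKind] at h <;> split_ifs at h

/-- **Homogenization** (Tavenas 2015, Prop. 2; folklore): the homogeneous components of degree
`≤ d` of the values of a straight-line program form a homogeneous circuit certificate on
`Fin len × Tag d`. [cite: Tavenas2015, §4, Prop. 2] -/
def homogenize : HomCircuit k σ (P.Node d) where
  rank := P.hrank d
  deg := P.hdeg d
  kind := P.hkind d
  val := P.hval d
  wf_var := by
    rintro ⟨i, tg⟩ j h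
    cases tg with
    | U e => exact P.opKind_var d h
    | V e => exact P.opKind_var d h
    | R e a => simp only [hkind] at h; split_ifs at h
    | Q e => simp only [hkind] at h; split at h <;> cases h
  wf_const := by
    rintro ⟨i, tg⟩ c h
    cases tg with
    | U e => exact P.opKind_const d h
    | V e => exact P.opKind_const d h
    | R e a => simp only [hkind] at h; split_ifs at h
    | Q e => simp only [hkind] at h; split at h <;> cases h
  wf_sum := by
    rintro ⟨i, tg⟩ args h
    cases tg with
    | U e => exact P.opKind_sum d h
    | V e => exact P.opKind_sum d h
    | R e a =>
      simp only [hkind] at h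
      split_ifs at h with hae
      cases h
      exact ⟨by simp, by simp [hval, hae]⟩
    | Q e =>
      simp only [hkind] at h
      split at h
      · next a u b v hl =>
        cases h
        refine ⟨?_, ?_⟩
        · intro x hx
          simp only [List.mem_cons, List.not_mem_nil, or_false] at hx
          rcases hx with rfl | rfl <;> simp [hrank, hdeg]
        · simp only [hval_U, hval_V, hval_Q, hl, List.map_cons, List.map_nil, List.sum_cons,
            List.sum_nil, add_zero]
          rw [P.val_eq i.val i.isLt, hl]
          simp only [SLine.evalAt, SLine.fst, SLine.snd, map_add, map_smul]
          rfl
      · next u v hl =>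
        cases h
        refine ⟨?_, ?_⟩
        · intro x hx
          simp only [List.mem_map, List.mem_finRange, true_and] at hx
          obtain ⟨a, rfl⟩ := hx
          simp [hrank, hdeg]
        · rw [List.map_map]
          have hfun : ((fun a : k × P.Node d => a.1 • P.hval d a.2) ∘ fun a : Fin (d + 1) =>
              ((1 : k), (i, Tag.R e a))) = fun a : Fin (d + 1) => if a.val ≤ e.val then
                homogeneousComponent a.val (P.opVal i.val u) *
                  homogeneousComponent (e.val - a.val) (P.opVal i.val v) else 0 := by
            funext a
            simp [hl, SLine.fst, SLine.snd]
          rw [hfun, ← Fin.sum_univ_def, Fin.sum_univ_eq_sum_range (fun a => if a ≤ e.val then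
                homogeneousComponent a (P.opVal i.val u) *
                  homogeneousComponent (e.val - a) (P.opVal i.val v) else 0) (d + 1),
            ← Finset.sum_filter]
          have hrange : (Finset.range (d + 1)).filter (fun a => a ≤ e.val) =
              Finset.range (e.val + 1) := by
            ext a
            simp only [Finset.mem_filter, Finset.mem_range]
            omega
          rw [hrange, hval_Q, P.val_eq i.val i.isLt, hl]
          exact homogeneousComponent_mul _ _ _
  wf_prod := by
    rintro ⟨i, tg⟩ a b h
    cases tg with
    | U e => exact (P.opKind_ne_prod d h).elim
    | V e => exact (P.opKind_ne_prod d h).elim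
    | R e a' =>
      simp only [hkind] at h
      split_ifs at h with hae
      simp only [HKind.prod.injEq] at h
      obtain ⟨rfl, rfl⟩ := h
      refine ⟨by simp [hrank], by simp [hrank], by simp [hdeg, finSub]; omega, ?_⟩
      simp [hval, hae, finSub]
    | Q e => simp only [hkind] at h; split at h <;> cases h

/-- The node type has at most `4 · len · (d + 1)²` elements.
[cite: Tavenas2015, §4, Prop. 2 (size s(d+1)²), coarsened] -/
theorem card_node_le : Fintype.card (P.Node d) ≤ 4 * P.len * (d + 1) ^ 2 := by
  classical
  let f : Tag d → Fin 4 × Fin (d + 1) × Fin (d + 1) := fun tg => match tg with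
    | .U e => (0, e, 0)
    | .V e => (1, e, 0)
    | .R e a => (2, e, a)
    | .Q e => (3, e, 0)
  have hf : Function.Injective f := by
    intro x y hxy
    cases x <;> cases y <;> simp [f] at hxy ⊢ <;> exact hxy
  have hT : Fintype.card (Tag d) ≤ 4 * (d + 1) ^ 2 := by
    refine (Fintype.card_le_of_injective f hf).trans ?_
    simp [pow_two]
  rw [show Fintype.card (P.Node d) = P.len * Fintype.card (Tag d) by
    simp [Node, Fintype.card_prod]]
  calc P.len * Fintype.card (Tag d) ≤ P.len * (4 * (d + 1) ^ 2) := Nat.mul_le_mul_left _ hT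
    _ = 4 * P.len * (d + 1) ^ 2 := by ring

/-- Expansion of the homogenization: every homogeneous component of degree `e ≤ d` of a value of a
straight-line program is a short sum of products of low-degree polynomials.
[cite: Tavenas2015, Thm. 1; AgrawalVinay2008] -/
theorem exists_sum_prod_component {t : ℕ} (ht : 1 ≤ t) (i : Fin P.len) (e : Fin (d + 1)) :
    ∃ L : List (List (MvPolynomial σ k)),
      (L.map List.prod).sum = homogeneousComponent e.val (P.val i.val) ∧
      L.length ≤ ((4 * P.len * (d + 1) ^ 2) * (4 * P.len * (d + 1) ^ 2)) ^ (8 * e.val / (t + 1)) ∧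
      ∀ T ∈ L, T.length ≤ 1 + 4 * (8 * e.val / (t + 1)) ∧ ∀ p ∈ T, p.totalDegree ≤ t := by
  classical
  obtain ⟨L, h1, h2, h3⟩ := (P.homogenize d).exists_sum_prod ht (i, Tag.Q e)
  refine ⟨L, h1, h2.trans ?_, h3⟩
  exact Nat.pow_le_pow_left (Nat.mul_le_mul (P.card_node_le d) (P.card_node_le d)) _

omit d in
/-- The sum of the homogeneous components of degree `≤ d` of `φ` is `φ` when `deg φ ≤ d`.
[folklore] -/
theorem _root_.Literature.Computability.AlgebraicComplexity.DepthReduction.sum_homogeneousComponent_of_le {φ : MvPolynomial σ k}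
    {d : ℕ} (hd : φ.totalDegree ≤ d) :
    ∑ e ∈ Finset.range (d + 1), homogeneousComponent e φ = φ := by
  conv_rhs => rw [← sum_homogeneousComponent φ]
  symm
  apply Finset.sum_subset
  · intro e he
    simp only [Finset.mem_range] at he ⊢
    omega
  · intro e _ he
    simp only [Finset.mem_range, not_lt] at he
    exact homogeneousComponent_eq_zero _ _ (by omega)

/-- **Algebraic core of the depth reduction** (Tavenas 2015, Thm. 1, in the Agrawal–Vinay
expansion form): a value `f` of a straight-line program of length `L`, of total degree `≤ d`,
is a sum of at most `(d + 1) · S ^ (16 d / (t + 1))` products of at most `1 + 32 d / (t + 1)`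
polynomials of total degree `≤ t` each, where `S = 4 L (d + 1)²`, for every `t ≥ 1`.
[cite: Tavenas2015, Thm. 1 and Lemma 3; AgrawalVinay2008] -/
theorem exists_sum_prod {t : ℕ} (ht : 1 ≤ t) {i : ℕ} (hi : i < P.len)
    (hd : (P.val i).totalDegree ≤ d) :
    ∃ L : List (List (MvPolynomial σ k)),
      (L.map List.prod).sum = P.val i ∧
      L.length ≤ (d + 1) *
        ((4 * P.len * (d + 1) ^ 2) * (4 * P.len * (d + 1) ^ 2)) ^ (8 * d / (t + 1)) ∧
      ∀ T ∈ L, T.length ≤ 1 + 4 * (8 * d / (t + 1)) ∧ ∀ p ∈ T, p.totalDegree ≤ t := by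
  classical
  set S2 := (4 * P.len * (d + 1) ^ 2) * (4 * P.len * (d + 1) ^ 2) with hS2
  have hS2pos : 0 < S2 := by
    have : 0 < P.len := by omega
    positivity
  choose Lf hLf using fun e : Fin (d + 1) => P.exists_sum_prod_component d ht ⟨i, hi⟩ e
  refine ⟨(List.finRange (d + 1)).flatMap Lf, ?_, ?_, ?_⟩
  · rw [List.map_flatMap, sum_flatMap, ← sum_homogeneousComponent_of_le hd,
      ← Fin.sum_univ_eq_sum_range (fun e => homogeneousComponent e (P.val i)) (d + 1),
      Fin.sum_univ_def]
    congr 1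
    apply List.map_congr_left
    intro e _
    exact (hLf e).1
  · rw [List.length_flatMap]
    refine (List.sum_le_card_nsmul _ (S2 ^ (8 * d / (t + 1))) ?_).trans ?_
    · intro x hx
      obtain ⟨e, -, rfl⟩ := List.mem_map.1 hx
      refine (hLf e).2.1.trans ?_
      apply Nat.pow_le_pow_right hS2pos
      apply Nat.div_le_div_right
      have := e.isLt
      omega
    · simp
  · intro T hT
    obtain ⟨e, -, hT⟩ := List.mem_flatMap.1 hT
    obtain ⟨h1, h2⟩ := (hLf e).2.2 T hT
    refine ⟨h1.trans ?_, h2⟩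
    have := e.isLt
    apply Nat.add_le_add_left
    apply Nat.mul_le_mul_left
    apply Nat.div_le_div_right
    omega


end SLP

end SLP

end Literature.Computability.AlgebraicComplexity.DepthReduction
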